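import Summits.ValiantsHypothesis.ValiantsHypothesis.Theorems.BarrierLeverChainCertificateSufficesCycle

/-!
# Route BarrierLever — the CHAIN-certificate reduction for UT-D (item 19316), part 2/3:
# chain sets and the BLOCK LEMMA

Helper file (`--supports stmt-ValiantsHypothesis-19316`; cell valiant-natproofs, rung V4, 𝒟-side;
prover seat val-np-p1; planner memo `HOME/p1/UTD-memo-g9.md` §3(p)). Closes NO item. Part 1/3
(`BarrierLeverChainCertificateSufficesCycle.lean`) supplies the chain weight `cwt`, the costs
`ccost`, chain values `chainVal`, the one-cycle lemma and the cycle cost `ccost_incCycle`; part 3/3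
(`BarrierLeverChainCertificateSuffices.lean`) proves the outer comparison and the reduction.

**The chain set** `chainSet e x y ⊆ ℕ` of a block `(x, y)` (row point `x`, column point `y`,
mismatch set `M = x ∆ y`), spelled with the literal encodings `castAdd / natAdd` of the route's
statements so that an item can quote it verbatim: the LOOP value `e (ρ_x m) (κ_y m)` when
`M = {m}`, and for every strictly increasing chain `c : Fin (k+2) → Fin h` (at least two points)
COVERING `M` its chain value `e (ρ_x c_{k+1}) (κ_y c₀) + Σ_{i ≤ k} e (ρ_x c_i) (κ_y c_{i+1})`.
It is nonempty for `x ≠ y` (`chainSet_nonempty`: the loop if `|M| = 1`, the sorted `M` if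
`|M| ≥ 2`) and bounded by `h·E` if `e ≤ E` (`sInf_chainSet_le`).

**THE BLOCK LEMMA** (`le_ccost`, `exists_ccost_eq`, `inf_ccost_eq`; planner-validated by brute
force at `h = 4, 5`): if `e ≤ E`, `h·E ≤ B` and `x ≠ y`, then
`min_τ ccost e B x y τ = B + min (chainSet e x y)`. Lower bound: an inner assignment pays `≥ B`
at each descent and at each fixed mismatch coordinate; two payments give `2B ≥ B + chain`; no
payment is impossible (`Descent.eq_one_of_forall_le`); exactly one payment is a fixed mismatch `s`
with `τ = 1`, `M = {s}` (the loop value), or a unique descent `s` with no fixed mismatch, and then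
the ONE-CYCLE LEMMA of part 1 says `τ` is the increasing cycle of its moved set `T ⊇ M`,
`|T| ≥ 2`, whose cost is `B +` the chain value of `T`. Upper bound: the identity realises a loop
value, the increasing cycle on the chain realises a chain value (`Finset.orderEmbOfFin_unique`).
Identity blocks have tropical determinant `0` (`inf_ccost_self`).

WHAT THIS IS NOT: no statement about layouts (part 3); nothing on UT-D in general (item 19316),
on TT / TNS / item 19717, on crux stmt-ValiantsHypothesis-14610, or on `VP` versus `VNP`.
-/

-- layout Summits/ValiantsHypothesis/ValiantsHypothesis forces the duplicated namespace component
set_option linter.dupNamespace false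

namespace Summit.ValiantsHypothesis.ValiantsHypothesis.Theorems.BarrierLever.ChainCert

open Finset
open Summit.ValiantsHypothesis.ValiantsHypothesis.Theorems.BarrierLever.NearPrincipal
open Summit.ValiantsHypothesis.ValiantsHypothesis.Theorems.BarrierLever.Descent

variable {h : ℕ}

/-! ## 1. Chain sets -/

/-- The CHAIN SET of the block `(x, y)` under the valuation `e` (spelled with the literal
encodings of the route's statements): the loop value `e (ρ_x a) (κ_y a)` when the mismatch set is
`{a}`, and the chain values of all strictly increasing chains `c : Fin (k+2) → Fin h` covering the
mismatch set. -/
def chainSet (e : Fin (h + h) → Fin (h + h) → ℕ) (x y : Finset (Fin h)) : Set ℕ :=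
  {n : ℕ |
    (∃ a : Fin h, (∀ m : Fin h, (m ∈ x ↔ m ∉ y) ↔ m = a) ∧
      n = e (if a ∈ x then Fin.castAdd h a else Fin.natAdd h a)
            (if a ∈ y then Fin.natAdd h a else Fin.castAdd h a)) ∨
    (∃ (k : ℕ) (c : Fin (k + 2) → Fin h), StrictMono c ∧
      (∀ m : Fin h, (m ∈ x ↔ m ∉ y) → ∃ i, c i = m) ∧
      n = e (if c (Fin.last (k + 1)) ∈ x then Fin.castAdd h (c (Fin.last (k + 1)))
              else Fin.natAdd h (c (Fin.last (k + 1))))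
            (if c 0 ∈ y then Fin.natAdd h (c 0) else Fin.castAdd h (c 0)) +
          ∑ i : Fin (k + 1), e (if c i.castSucc ∈ x then Fin.castAdd h (c i.castSucc)
              else Fin.natAdd h (c i.castSucc))
            (if c i.succ ∈ y then Fin.natAdd h (c i.succ) else Fin.castAdd h (c i.succ)))}

/-- Loop values are in the chain set. -/
theorem mem_chainSet_loop (e : Fin (h + h) → Fin (h + h) → ℕ) (x y : Finset (Fin h)) {a : Fin h}
    (hM : ∀ m : Fin h, (m ∈ x ↔ m ∉ y) ↔ m = a) :
    e (rowL x a) (colL y a) ∈ chainSet e x y :=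
  Or.inl ⟨a, hM, rfl⟩

/-- Chain values of strictly increasing covering chains are in the chain set. -/
theorem mem_chainSet_chain (e : Fin (h + h) → Fin (h + h) → ℕ) (x y : Finset (Fin h)) {k : ℕ}
    (c : Fin (k + 2) → Fin h) (hc : StrictMono c)
    (hcov : ∀ m : Fin h, (m ∈ x ↔ m ∉ y) → ∃ i, c i = m) :
    chainVal e x y c ∈ chainSet e x y :=
  Or.inr ⟨k, c, hc, hcov, rfl⟩

/-- Every element of the chain set is at most `h·E` if `e ≤ E` (a chain has at most `h` pairs). -/
theorem le_of_mem_chainSet (e : Fin (h + h) → Fin (h + h) → ℕ) (x y : Finset (Fin h)) (E : ℕ)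
    (hE : ∀ p q, e p q ≤ E) {n : ℕ} (hn : n ∈ chainSet e x y) : n ≤ h * E := by
  rcases hn with ⟨a, -, rfl⟩ | ⟨k, c, hc, -, rfl⟩
  · calc _ ≤ E := hE _ _
      _ = 1 * E := (one_mul E).symm
      _ ≤ h * E := Nat.mul_le_mul_right _ (Fin.pos a)
  · have hk : k + 2 ≤ h := by
      have := Fintype.card_le_of_injective c hc.injective
      simpa using this
    calc _ ≤ E + ∑ _i : Fin (k + 1), E := Nat.add_le_add (hE _ _) (sum_le_sum (fun i _ => hE _ _))
      _ = (k + 2) * E := by rw [sum_const, card_univ, Fintype.card_fin, smul_eq_mul]; ring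
      _ ≤ h * E := Nat.mul_le_mul_right _ hk

/-- The chain minimum is at most `h·E` if `e ≤ E`. -/
theorem sInf_chainSet_le (e : Fin (h + h) → Fin (h + h) → ℕ) (x y : Finset (Fin h)) (E : ℕ)
    (hE : ∀ p q, e p q ≤ E) : sInf (chainSet e x y) ≤ h * E := by
  rcases (chainSet e x y).eq_empty_or_nonempty with h0 | hne
  · rw [h0, Nat.sInf_empty]
    exact Nat.zero_le _
  · exact le_of_mem_chainSet e x y E hE (Nat.sInf_mem hne)

/-- The mismatch set of a block as a finset, with its membership lemma. -/
theorem mem_mismatch (x y : Finset (Fin h)) (m : Fin h) :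
    m ∈ univ.filter (fun m => (m ∈ x ↔ m ∉ y)) ↔ (m ∈ x ↔ m ∉ y) := by
  rw [mem_filter]; simp only [mem_univ, true_and]

/-- A block with distinct row and column points has a nonempty mismatch set. -/
theorem mismatch_nonempty (x y : Finset (Fin h)) (hxy : x ≠ y) :
    (univ.filter (fun m => (m ∈ x ↔ m ∉ y))).Nonempty := by
  by_contra hcon
  rw [Finset.not_nonempty_iff_eq_empty] at hcon
  apply hxy
  ext m
  by_contra hm
  have hmM : m ∈ univ.filter (fun m => (m ∈ x ↔ m ∉ y)) := (mem_mismatch x y m).mpr (by tauto)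
  rw [hcon] at hmM
  exact Finset.notMem_empty m hmM

/-- A block with distinct row and column points has a nonempty chain set (the loop if `|M| = 1`,
the sorted mismatch set as a chain if `|M| ≥ 2`). -/
theorem chainSet_nonempty (e : Fin (h + h) → Fin (h + h) → ℕ) (x y : Finset (Fin h))
    (hxy : x ≠ y) : (chainSet e x y).Nonempty := by
  set M := univ.filter (fun m => (m ∈ x ↔ m ∉ y)) with hMdef
  have hMne : M.Nonempty := mismatch_nonempty x y hxy
  rcases Nat.exists_eq_add_of_le (Finset.card_pos.mpr hMne) with ⟨n, hn⟩
  rcases n with _ | k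
  · -- `|M| = 1`: the loop
    obtain ⟨a, ha⟩ := Finset.card_eq_one.mp (by rw [hn])
    refine ⟨_, mem_chainSet_loop e x y (a := a) (fun m => ?_)⟩
    rw [← mem_mismatch x y m, ← hMdef, ha, mem_singleton]
  · -- `|M| = k + 2`: the sorted mismatch set
    have hk : M.card = k + 2 := by rw [hn]; ring
    refine ⟨_, mem_chainSet_chain e x y (fun i => M.orderEmbOfFin hk i)
      (M.orderEmbOfFin hk).strictMono (fun m hm => ?_)⟩
    have hm' : m ∈ Set.range (M.orderEmbOfFin hk) := by
      rw [range_orderEmbOfFin, mem_coe]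
      exact (mem_mismatch x y m).mpr hm
    exact hm'

/-! ## 2. The block lemma -/

/-- A loop block (`M = {s}`) costs exactly `B + e (ρ_x s, κ_y s)` at the identity. -/
theorem ccost_one_of_loop (e : Fin (h + h) → Fin (h + h) → ℕ) (B : ℕ) (x y : Finset (Fin h))
    {s : Fin h} (hM : ∀ m : Fin h, (m ∈ x ↔ m ∉ y) ↔ m = s) :
    ccost e B x y 1 = B + e (rowL x s) (colL y s) := by
  unfold ccost
  rw [Finset.sum_eq_single s]
  · rw [Equiv.Perm.coe_one, id]
    exact cwt_lit_loop e B x y ((mismatch_iff x y s).mp ((hM s).mpr rfl))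
  · intro m _ hms
    rw [Equiv.Perm.coe_one, id]
    refine cwt_lit_agree e B x y ?_
    have hm := hM m
    tauto
  · intro hns
    exact absurd (mem_univ s) hns

/-- BLOCK LOWER BOUND: if `e ≤ E`, `h·E ≤ B` and the block `(x, y)` has a mismatch, every inner
assignment costs at least `B + min (chainSet e x y)`. -/
theorem le_ccost (e : Fin (h + h) → Fin (h + h) → ℕ) (E B : ℕ) (hE : ∀ p q, e p q ≤ E)
    (hB : h * E ≤ B) (x y : Finset (Fin h)) (hxy : x ≠ y) (τ : Equiv.Perm (Fin h)) :
    B + sInf (chainSet e x y) ≤ ccost e B x y τ := by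
  classical
  have hinf : sInf (chainSet e x y) ≤ B := (sInf_chainSet_le e x y E hE).trans hB
  -- a mismatch coordinate exists
  obtain ⟨m₀, hm₀⟩ : ∃ m, (m ∈ x ↔ m ∉ y) := by
    obtain ⟨m, hm⟩ := mismatch_nonempty x y hxy
    exact ⟨m, (mem_mismatch x y m).mp hm⟩
  -- the paying coordinates: descents and fixed mismatches
  set f : Fin h → ℕ := fun m => cwt e B (rowL x m) (colL y (τ m)) with hf
  have hbc : ccost e B x y τ = ∑ m, f m := rfl
  set S := univ.filter (fun m => τ m < m ∨ (τ m = m ∧ (m ∈ x ↔ m ∉ y))) with hS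
  have hmemS : ∀ m, m ∈ S ↔ τ m < m ∨ (τ m = m ∧ (m ∈ x ↔ m ∉ y)) := fun m => by
    rw [hS, mem_filter]; simp only [mem_univ, true_and]
  have hSB : ∀ m ∈ S, B ≤ f m := fun m hm => le_cwt_lit_of_not_fwd e B x y ((hmemS m).mp hm)
  have hsumS : S.card * B ≤ ∑ m, f m :=
    calc S.card * B = ∑ m ∈ S, B := by rw [sum_const, smul_eq_mul]
      _ ≤ ∑ m ∈ S, f m := sum_le_sum hSB
      _ ≤ ∑ m, f m := sum_le_sum_of_subset_of_nonneg (subset_univ _) (fun _ _ _ => Nat.zero_le _)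
  rw [hbc]
  by_cases h2 : 2 ≤ S.card
  · -- two paying coordinates already exceed `B + chain`
    calc B + sInf (chainSet e x y) ≤ B + B := Nat.add_le_add_left hinf _
      _ = 2 * B := (two_mul B).symm
      _ ≤ S.card * B := Nat.mul_le_mul_right _ h2
      _ ≤ ∑ m, f m := hsumS
  -- otherwise exactly one paying coordinate `s`
  have hone : (∀ m, ¬ τ m < m) → τ = 1 := fun hnd =>
    eq_one_of_forall_le τ (fun m => not_lt.mp (hnd m))
  have hSne : S.Nonempty := by
    by_contra hemp
    rw [Finset.not_nonempty_iff_eq_empty] at hemp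
    have h1 : τ = 1 := hone (fun m hm => by
      have hmS : m ∈ S := (hmemS m).mpr (Or.inl hm)
      rw [hemp] at hmS
      exact Finset.notMem_empty m hmS)
    have hm₀S : m₀ ∈ S := (hmemS m₀).mpr (Or.inr ⟨by rw [h1]; rfl, hm₀⟩)
    rw [hemp] at hm₀S
    exact Finset.notMem_empty m₀ hm₀S
  obtain ⟨s, hSs⟩ : ∃ s, S = {s} := by
    rw [← Finset.card_eq_one]
    have := hSne.card_pos
    omega
  have hsS : s ∈ S := by rw [hSs]; exact mem_singleton_self s
  have huniqS : ∀ m ∈ S, m = s := fun m hm => by rw [hSs] at hm; exact mem_singleton.mp hm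
  rcases (hmemS s).mp hsS with hlt | ⟨hfix, hmis⟩
  · -- `s` is the unique descent and no mismatch coordinate is fixed: ONE CYCLE
    have hdesc_eq : ∀ m, τ m < m → m = s := fun m hm => huniqS m ((hmemS m).mpr (Or.inl hm))
    have hnofix : ∀ m, (m ∈ x ↔ m ∉ y) → τ m ≠ m := by
      intro m hmis hfix
      have hms := huniqS m ((hmemS m).mpr (Or.inr ⟨hfix, hmis⟩))
      rw [hms] at hfix
      exact hlt.ne hfix
    set T := univ.filter (fun m => τ m ≠ m) with hT
    have hmemT : ∀ m, m ∈ T ↔ τ m ≠ m := fun m => by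
      rw [hT, mem_filter]; simp only [mem_univ, true_and]
    -- `T` has at least the two elements `s`, `τ s`
    have hcard2 : 2 ≤ T.card := by
      have hsub : ({s, τ s} : Finset (Fin h)) ⊆ T := by
        intro m hm
        rw [mem_insert, mem_singleton] at hm
        rcases hm with rfl | rfl
        · exact (hmemT _).mpr hlt.ne
        · exact (hmemT _).mpr (apply_ne_of_ne τ hlt.ne)
      have hc : ({s, τ s} : Finset (Fin h)).card = 2 := card_pair hlt.ne'
      exact hc ▸ card_le_card hsub
    obtain ⟨k, hk⟩ : ∃ k, T.card = k + 2 := ⟨T.card - 2, by omega⟩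
    have hk' : (univ.filter (fun m => τ m ≠ m)).card = (k + 1) + 1 := by rw [← hT, hk]
    have hτeq : τ = incCycle T (k + 2) hk := by
      have := eq_incCycle_of_unique_descent τ s hlt hdesc_eq (k + 1) hk'
      exact this
    have hcost : ∑ m, f m = B + chainVal e x y (fun i => ((T.orderIsoOfFin hk i : T) : Fin h)) := by
      have := ccost_incCycle e B x y T k hk (fun m hm => (hmemT m).mpr (hnofix m hm))
      rw [← hτeq] at this
      exact this
    rw [hcost]
    refine Nat.add_le_add_left (Nat.sInf_le (mem_chainSet_chain e x y _ ?_ ?_)) _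
    · intro i j hij
      rw [Subtype.coe_lt_coe, OrderIso.lt_iff_lt]
      exact hij
    · intro m hm
      exact ⟨(T.orderIsoOfFin hk).symm ⟨m, (hmemT m).mpr (hnofix m hm)⟩,
        by rw [OrderIso.apply_symm_apply]⟩
  · -- `s` is a fixed mismatch coordinate; then `τ = 1` and the mismatch set is `{s}`: LOOP
    have h1 : τ = 1 := hone (fun m hm => by
      have hms := huniqS m ((hmemS m).mpr (Or.inl hm))
      rw [hms, hfix] at hm
      exact lt_irrefl _ hm)
    have hM1 : ∀ m : Fin h, (m ∈ x ↔ m ∉ y) ↔ m = s := by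
      intro m
      constructor
      · intro hm
        exact huniqS m ((hmemS m).mpr (Or.inr ⟨by rw [h1]; rfl, hm⟩))
      · rintro rfl
        exact hmis
    have hcost : ∑ m, f m = B + e (rowL x s) (colL y s) := by
      have := ccost_one_of_loop e B x y hM1
      rw [← h1] at this
      exact this
    rw [hcost]
    exact Nat.add_le_add_left (Nat.sInf_le (mem_chainSet_loop e x y hM1)) _

/-- BLOCK UPPER BOUND: a block with a mismatch has an inner assignment of cost exactly
`B + min (chainSet e x y)` (the identity for a loop value, the increasing cycle on the chain for a
chain value). -/
theorem exists_ccost_eq (e : Fin (h + h) → Fin (h + h) → ℕ) (B : ℕ) (x y : Finset (Fin h))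
    (hxy : x ≠ y) : ∃ τ : Equiv.Perm (Fin h), ccost e B x y τ = B + sInf (chainSet e x y) := by
  classical
  have hmem := Nat.sInf_mem (chainSet_nonempty e x y hxy)
  rcases hmem with ⟨a, hM, hn⟩ | ⟨k, c, hc, hcov, hn⟩
  · refine ⟨1, ?_⟩
    rw [hn]
    exact ccost_one_of_loop e B x y hM
  · set s : Finset (Fin h) := univ.image c with hsdef
    have hk : s.card = k + 2 := by
      rw [hsdef, card_image_of_injective _ hc.injective, card_univ, Fintype.card_fin]
    refine ⟨incCycle s (k + 2) hk, ?_⟩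
    have hcs : ∀ i, c i ∈ s := fun i => by rw [hsdef]; exact mem_image_of_mem c (mem_univ i)
    have hF : (fun i => ((s.orderIsoOfFin hk i : s) : Fin h)) = c := by
      have h1 := Finset.orderEmbOfFin_unique hk hcs hc
      funext i
      rw [Finset.coe_orderIsoOfFin_apply, ← h1]
    rw [ccost_incCycle e B x y s k hk (fun m hm => ?_), hF, hn]
    · rfl
    · obtain ⟨i, hi⟩ := hcov m hm
      rw [← hi]
      exact hcs i

/-- THE BLOCK LEMMA: if `e ≤ E` and `h·E ≤ B`, the tropical determinant (minimum inner cost) of a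
block `(x, y)` with `x ≠ y` is exactly `B + min (chainSet e x y)`. -/
theorem inf_ccost_eq (e : Fin (h + h) → Fin (h + h) → ℕ) (E B : ℕ) (hE : ∀ p q, e p q ≤ E)
    (hB : h * E ≤ B) (x y : Finset (Fin h)) (hxy : x ≠ y) :
    univ.inf' univ_nonempty (ccost e B x y) = B + sInf (chainSet e x y) := by
  apply le_antisymm
  · obtain ⟨τ, hτ⟩ := exists_ccost_eq e B x y hxy
    exact (inf'_le _ (mem_univ τ)).trans hτ.le
  · exact le_inf' _ _ (fun τ _ => le_ccost e E B hE hB x y hxy τ)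

/-- An identity block has tropical determinant `0`. -/
theorem inf_ccost_self (e : Fin (h + h) → Fin (h + h) → ℕ) (B : ℕ) (x : Finset (Fin h)) :
    univ.inf' univ_nonempty (ccost e B x x) = 0 :=
  le_antisymm ((inf'_le _ (mem_univ 1)).trans (ccost_one_self e B x).le) (Nat.zero_le _)

end Summit.ValiantsHypothesis.ValiantsHypothesis.Theorems.BarrierLever.ChainCert
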